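import Summits.QuantumFields.YangMills.Theorems.BalabanUVNodesN15UnitLayerBgTorusLetters
import Summits.QuantumFields.YangMills.Theorems.BalabanUVNodesN15BackgroundByPartsPrimitive
import Literature.MathematicalPhysics.QuantumFieldTheory.Balaban1983to89.T4Cov2156Rate

/-!
# Route «BalabanUVNodes», cluster K4 «SpineRates» — node N15 = NE2, UNIT-LATTICE LAYER WITH THE BACKGROUND LIVE, file U-C2 (dag-n15-a g16, LOCATED-1):
# THE MIDDLE FACTOR's LETTERS AT ONE INDEX OF dag-n15-c's PRIMITIVE-CARRIER FAMILY, read as BOND MATRICES of b06's torus scheme — explicit constants from FILE 8's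
# uniform `U ≡ 1` letters and the (3.35) letters ALONE (both Neumann guards below `½`, NO weight window); the uniform `∃`-packaging is file U-C3

Cell `pub-ymgap`, seat `pub-ymgap-dag-n15-a` (-a KNIT-BY-NAME seat of node N15; HUMAN RULING D-0062; chair R424 venue), generation 16, file U-C2 of the LOCATED-1
programme (INBOX l.22312 ∕ l.22757 ∕ l.22887).  `bears_on: R4∕N15 · K3⁷ SpineGivenEndpointR13SepCoPH (stmt-QuantumFields-20544)`.  Filed `--kind proof --supports
stmt-QuantumFields-20544 --as helper` — COUNT-NEUTRAL.  Two data `def`s (`boxBondTor`, `unitBondMat`), the rest theorems; 0 `sorry`.  Imports BY NAME file U-C `…N15UnitLayerBgTorusLetters`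
(`zOp`, `wOp`, `hasMaj_wOp`, `hasMaj_VX`, `isUnit_pair`, `hasMaj_zOp`, `hasMaj_grad_wOp_qvAdj`, `hasMaj_zOp_sub`, `idef_sub_sub`), dag-n15-c FILE 11 `…N15BackgroundByPartsPrimitive`
(`fgInstanceC2`, `reg_slim_of_C2`; through it n15-b B4 `hasMaj_entry01_background₁`, B0 `abs_blockAvg_le`) and pub-balaban `T4Cov2156Rate` (b06's torus scheme: `pbox`, `pdist`,
`toT`∕`rep`, `B6UnitTorusCarrier.pdist_rep_rep`); nothing in the tree is modified.

WHAT.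
* §1 the bond-matrix dictionary: def `boxBondTor M p := (toT M p.1, p.2)` (b06's box bond ↦ King's torus bond), `pdist_eq_tdistT_boxBondTor`, def `unitBondMat M T` (`toMatrix′ T`
  read at `boxBondTor`: a unit-lattice operator as a bond matrix), `unitBondMat_sub`, `unitBondMat_zero`, ★ `abs_unitBondMat_le_of_hasMaj` (a sharp-block majorant
  `B·e^{−δ|y−y′|_T}` on unit 1-forms blocked by their site IS an entry letter `|unitBondMat T (b,b′)| ≤ B·e^{−δρ_M(b₋,b′₋)}`);
* §2 `inv_pow_le_sixteenth`, ★★ `hasMaj_zOp_letters_at` — ONE index `i = ((m_T, k, m), ν)`, explicit constants: from FILE 8's letters 1–4, 6, 7 at `γ = 1∕16` (as hypotheses in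
  `uniform_layer_fullG`'s shape), the `coeffBg₁` letters that FILE 11 `reg_slim_of_C2` (component 1) derives from a configuration regular at level `c₃₅` on the PRIMITIVE
  carrier, and `0 < α₀ ≤ a₁ ≤ 1` with both Neumann guards `≤ ½`: `Z^{(k)}(Ū), Z^{(k+m)}(U) ≤ ζ₀α₀·e^{−(δ∕2)d}` and `Z^{(k+m)}(U) − Z^{(k)}(Ū) ≤ τ₀·(L^k)^{−1∕16}·e^{−(δ∕4)d}` as block
  majorants on unit 1-forms blocked by their site (`Ū = avg₁ kingPrV U`) — U-C's one-torus lemmas + n15-b B4 `hasMaj_entry01_background₁` minus FILE 8's entry 0 (`idef_sub_sub`).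
  ONE `set_option maxHeartbeats 800000 in` on this assembly (the device of n15-c's 7a ∕ U3 ∕ R2u at 400000).

HONEST FRAMING.  Count-neutral assembly BY NAME; the only analysis is in the cited files; MODEL-LEVEL exactly as the by-parts family is (abelianised first-order species and
`Q`, block-averaged coarse partner, linearised dressing downstream); GENUINE full `U ≡ 1` propagator.  NOT [B9] Thm 3.15 at a general `U`; N15 NOT discharged (typed 28∕28 ·
discharged 5∕27 of record unchanged); nothing continuum ∕ ℝ⁴ ∕ OS ∕ mass-gap ∕ Clay.  Restate-immune (no Theses import).
-/

set_option autoImplicit false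

noncomputable section

open scoped BigOperators
open Finset

namespace Summit.QuantumFields.YangMills.BalabanUVNodes.N15.UnitLayerBg

open Literature.MathematicalPhysics.QuantumFieldTheory.Balaban1983to89
open Literature.MathematicalPhysics.QuantumFieldTheory.Balaban1983to89.B11SectG (BlockNorm HasMaj RowSum hasMaj_comp_exp)
open Literature.MathematicalPhysics.QuantumFieldTheory.Balaban1983to89.T4EtaRateDefect (idef)
open Literature.MathematicalPhysics.QuantumFieldTheory.Balaban1983to89.T4EtaRateCoeffDefect (pull blockAvg)
open Literature.MathematicalPhysics.QuantumFieldTheory.Balaban1983to89.B5Prop11Plancherel (Tor fine)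
open Literature.MathematicalPhysics.QuantumFieldTheory.Balaban1983to89.B6UnitTorusCarrier (unitTorusGeo triangle254_unitTorusGeo rowSum_unitTorusGeo unitTorusGeo_dist_nonneg
  unitTorusGeo_dist_self pdist_rep_rep)
open Literature.MathematicalPhysics.QuantumFieldTheory.Balaban1983to89.B4Sect5Proof (latticeConst latticeConst_nonneg)
open Literature.MathematicalPhysics.QuantumFieldTheory.Balaban1983to89.B11AxialTransport190 (abs_le_loc_ofBlocks loc_ofBlocks_le)
open Literature.MathematicalPhysics.QuantumFieldTheory.Balaban1983to89.B6Lemma24Torus (pbox)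
open Literature.MathematicalPhysics.QuantumFieldTheory.Balaban1983to89.B6BondEliminationTorus (pdist)
open Literature.MathematicalPhysics.QuantumFieldTheory.Balaban1983to89.B6Cov2156Torus (one_le_M)
open Literature.MathematicalPhysics.QuantumFieldTheory.Balaban1983to89.B6LowerBound2153Torus (toT rep toT_rep rep_toT rep_mem_pbox)
open Literature.MathematicalPhysics.QuantumFieldTheory.King1986 (exp_decay_mono)
open Literature.MathematicalPhysics.QuantumFieldTheory.King1986.Torus (blockOf tdistT tdistT_nonneg tdistT_self)
open Summit.QuantumFields.YangMills.BalabanUVNodes.N15.TwoGrid (gOp symbOp sD qvRe qvAdjRe TGIndex)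
open Summit.QuantumFields.YangMills.BalabanUVNodes.N15.VectorPiece (blkFine kingPrV blkFine_comp_kingPrV bshiftEquiv)
open Summit.QuantumFields.YangMills.BalabanUVNodes.N15.BackgroundLayer (bgPair projO unstack avg₁ fgD fgInstanceC2 reg_slim_of_C2 uniform_layer_fullG hasMaj_entry01_background₁
  abs_blockAvg_le bgConst bgConst_nonneg inv_pow_le_rate)
open Summit.QuantumFields.YangMills.BalabanUVNodes.N15.BackgroundModel (kappa_ofBlocks)

variable {d : ℕ}

/-! ## §1 The bond-matrix dictionary: a unit-lattice operator read on b06's box bonds -/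

section Dict

variable (M : Fin (d + 1) → ℕ) [∀ μ, NeZero (M μ)]

/-- b06's BOX BOND `(z, ν)` (`z ∈ pbox M`) ↦ KING's TORUS BOND `(toT z, ν)`. [cite: Balaban1987RG1, (1.9) p.252 (periodic distance on the torus: dictionary)] -/
def boxBondTor (p : B4.Idx (pbox M) (d + 1)) : Tor M × Fin (d + 1) := (toT M (p.1 : Fin (d + 1) → ℤ), p.2)

/-- `ρ_M(b₋, b′₋) = |toT b₋ − toT b′₋|_T` (`rep ∘ toT = id` on the box, `pdist_rep_rep`). [folklore] -/
theorem pdist_eq_tdistT_boxBondTor (p q : B4.Idx (pbox M) (d + 1)) :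
    pdist M (one_le_M M) (p.1 : Fin (d + 1) → ℤ) (q.1 : Fin (d + 1) → ℤ) = tdistT M (boxBondTor M p).1 (boxBondTor M q).1 := by
  have hp := rep_toT M p.1.2
  have hq := rep_toT M q.1.2
  show _ = tdistT M (toT M (p.1 : Fin (d + 1) → ℤ)) (toT M (q.1 : Fin (d + 1) → ℤ))
  rw [← pdist_rep_rep M (one_le_M M) (toT M (p.1 : Fin (d + 1) → ℤ)) (toT M (q.1 : Fin (d + 1) → ℤ)), hp, hq]

/-- A UNIT-LATTICE OPERATOR AS A BOND MATRIX of b06's torus scheme: `unitBondMat T (b, b′) = (T δ_{b′})(b)` read at the torus bonds. [folklore] -/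
def unitBondMat (T : (Tor M × Fin (d + 1) → ℝ) →ₗ[ℝ] (Tor M × Fin (d + 1) → ℝ)) : Matrix (B4.Idx (pbox M) (d + 1)) (B4.Idx (pbox M) (d + 1)) ℝ :=
  fun p q => LinearMap.toMatrix' T (boxBondTor M p) (boxBondTor M q)

/-- linearity: `unitBondMat (T − T′) = unitBondMat T − unitBondMat T′`. [folklore] -/
theorem unitBondMat_sub (T T' : (Tor M × Fin (d + 1) → ℝ) →ₗ[ℝ] (Tor M × Fin (d + 1) → ℝ)) : unitBondMat M (T - T') = unitBondMat M T - unitBondMat M T' := by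
  ext p q
  simp [unitBondMat, Matrix.sub_apply]

/-- `unitBondMat 0 = 0`. [folklore] -/
theorem unitBondMat_zero : unitBondMat M (0 : (Tor M × Fin (d + 1) → ℝ) →ₗ[ℝ] (Tor M × Fin (d + 1) → ℝ)) = 0 := by
  ext p q
  simp [unitBondMat]

variable {L : ℕ} (k : ℕ)

/-- ★ **A SHARP-BLOCK MAJORANT ON UNIT 1-FORMS BLOCKED BY THEIR SITE IS AN ENTRY LETTER**: `T ≤ B·e^{−δ|y−y′|_T}` (sites) ⟹ `|unitBondMat T (b,b′)| ≤ B·e^{−δρ_M(b₋,b′₋)}` — the test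
function `δ_{b′}` vanishes off the site `b′₋` and has size `1` there. [cite: Balaban1984PropagatorsII, (2.51) p.232 (block majorant: shape)] [folklore] -/
theorem abs_unitBondMat_le_of_hasMaj {T : (Tor M × Fin (d + 1) → ℝ) →ₗ[ℝ] (Tor M × Fin (d + 1) → ℝ)} {B δ : ℝ} (hB : 0 ≤ B)
    (h : HasMaj (BlockNorm.ofBlocks (unitTorusGeo L k M) (fun bb : Tor M × Fin (d + 1) => bb.1)) (BlockNorm.ofBlocks (unitTorusGeo L k M) (fun bb : Tor M × Fin (d + 1) => bb.1))
      T (fun y y' => B * Real.exp (-(δ * tdistT M y y')))) (p q : B4.Idx (pbox M) (d + 1)) :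
    |unitBondMat M T p q| ≤ B * Real.exp (-(δ * pdist M (one_le_M M) (p.1 : Fin (d + 1) → ℤ) (q.1 : Fin (d + 1) → ℤ))) := by
  classical
  rw [pdist_eq_tdistT_boxBondTor]
  unfold unitBondMat
  rw [LinearMap.toMatrix'_apply]
  -- the test function δ_{b′} is localised at the site of b′ with size ≤ 1
  have hloc : (BlockNorm.ofBlocks (unitTorusGeo L k M) (fun bb : Tor M × Fin (d + 1) => bb.1)).IsLoc (boxBondTor M q).1
      (Pi.single (boxBondTor M q) (1 : ℝ) : Tor M × Fin (d + 1) → ℝ) := by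
    intro x hx
    have hne : x ≠ boxBondTor M q := fun h => hx (by rw [h])
    simp [hne]
  have hsize : (BlockNorm.ofBlocks (unitTorusGeo L k M) (fun bb : Tor M × Fin (d + 1) => bb.1)).loc (boxBondTor M q).1
      (Pi.single (boxBondTor M q) (1 : ℝ) : Tor M × Fin (d + 1) → ℝ) ≤ 1 :=
    loc_ofBlocks_le (g := unitTorusGeo L k M) (fun bb : Tor M × Fin (d + 1) => bb.1) _ zero_le_one fun x _ => by
      by_cases hx : x = boxBondTor M q
      · subst hx; simp
      · simp [hx]
  have hmain := h (boxBondTor M q).1 _ hloc (boxBondTor M p).1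
  have hpt := abs_le_loc_ofBlocks (g := unitTorusGeo L k M) (fun bb : Tor M × Fin (d + 1) => bb.1) (T (Pi.single (boxBondTor M q) 1)) (x' := boxBondTor M p) rfl
  have hK : 0 ≤ B * Real.exp (-(δ * tdistT M (boxBondTor M p).1 (boxBondTor M q).1)) := mul_nonneg hB (Real.exp_nonneg _)
  calc |T (Pi.single (boxBondTor M q) 1) (boxBondTor M p)|
      ≤ (BlockNorm.ofBlocks (unitTorusGeo L k M) (fun bb : Tor M × Fin (d + 1) => bb.1)).loc (boxBondTor M p).1 (T (Pi.single (boxBondTor M q) 1)) := hpt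
    _ ≤ B * Real.exp (-(δ * tdistT M (boxBondTor M p).1 (boxBondTor M q).1)) *
          (BlockNorm.ofBlocks (unitTorusGeo L k M) (fun bb : Tor M × Fin (d + 1) => bb.1)).loc (boxBondTor M q).1 (Pi.single (boxBondTor M q) (1 : ℝ)) := hmain
    _ ≤ B * Real.exp (-(δ * tdistT M (boxBondTor M p).1 (boxBondTor M q).1)) * 1 := mul_le_mul_of_nonneg_left hsize hK
    _ = _ := mul_one _

end Dict

/-! ## §2 The letters at one index from the uniform `U ≡ 1` data (explicit constants) -/

section AtIndex

variable {L : ℕ} [NeZero L]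

omit [NeZero L] in
/-- `(L^k)⁻¹ ≤ (L^k)^{−1∕16}` (`L ≥ 1`), with the real power `(L:ℝ)^k` on both sides. [folklore] -/
theorem inv_pow_le_sixteenth (hL1 : (1 : ℝ) ≤ (L : ℝ)) (k : ℕ) : ((L : ℝ) ^ k)⁻¹ ≤ ((L : ℝ) ^ k) ^ (-(1 / 16 : ℝ)) := by
  have h := inv_pow_le_rate (L := L) (k := k) (γ := 1 / 16) hL1 (by norm_num)
  have e : (((L ^ k : ℕ) : ℝ)) = (L : ℝ) ^ k := by push_cast; ring
  rwa [e] at h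

set_option maxHeartbeats 800000 in
/-- ★★ **THE THREE LETTERS OF THE MIDDLE FACTOR AT ONE INDEX**, explicit constants.  Index `i = ((m_T, k, m), ν)`, uniform `U ≡ 1` data `(δ, β, m₀)` in the shape of FILE 8's
`uniform_layer_fullG` at `γ = 1∕16` (letters 1–4, 6, 7), `σ = δ∕4`, the level `c′ = (2d+3)c₃₅` of the `coeffBg₁` letters that FILE 11 `reg_slim_of_C2` derives from the primitive ones,
`0 < α₀ ≤ a₁ ≤ 1` with BOTH Neumann guards `≤ ½` at `a₁`; a configuration `U` regular at level `c₃₅` on the primitive carrier.  CONCLUSION (block majorants on unit 1-forms blocked by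
their site): `Z^{(k)}(Ū) ≤ ζ₀α₀·e^{−(δ∕2)d}`, `Z^{(k+m)}(U) ≤ ζ₀α₀·e^{−(δ∕2)d}`, `Z^{(k+m)}(U) − Z^{(k)}(Ū) ≤ τ₀·(L^k)^{−1∕16}·e^{−(δ∕4)d}` with
`ζ₀ = 2β²(d+2)c′·c_r·e^{δ}·c_r·e^{δ}` and `τ₀` the displayed sum (`c_r = c_r(δ∕4)`). [cite: Balaban1985BackgroundPropagators, (3.63)–(3.65) pp.402–403 (mechanism); King1986, Lemma 4.5 (4.38) p.674 (shape)] -/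
theorem hasMaj_zOp_letters_at (hL : Odd L ∧ 1 < L) {b c35 : ℝ} (hc35 : 0 < c35) (i : TGIndex × Fin (d + 1))
    {δ β m₀ α₀ a₁ : ℝ} (hδ : 0 < δ) (hβ : 0 ≤ β) (hm₀ : 0 ≤ m₀) (hα₀ : 0 < α₀) (hα₁ : α₀ ≤ a₁) (ha₁ : a₁ ≤ 1)
    (hq : β * ((2 * (d : ℝ) + 3) * c35 * ((d : ℝ) + 2)) * latticeConst (d + 1) (δ / 4) * a₁ ≤ 1 / 2)
    (hG : HasMaj (BlockNorm.ofBlocks (unitTorusGeo L i.1.k (TGIndex.Mn d hL i.1)) (blkFine L i.1.k (TGIndex.Mn d hL i.1)))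
      (BlockNorm.ofBlocks (unitTorusGeo L i.1.k (TGIndex.Mn d hL i.1)) (blkFine L i.1.k (TGIndex.Mn d hL i.1))) (gOp (TGIndex.Mn d hL i.1) (L ^ i.1.k) b)
      (fun y y' => β * Real.exp (-(δ * (unitTorusGeo L i.1.k (TGIndex.Mn d hL i.1)).dist y y'))))
    (hD : ∀ μ, HasMaj (BlockNorm.ofBlocks (unitTorusGeo L i.1.k (TGIndex.Mn d hL i.1)) (blkFine L i.1.k (TGIndex.Mn d hL i.1)))
      (BlockNorm.ofBlocks (unitTorusGeo L i.1.k (TGIndex.Mn d hL i.1)) (blkFine L i.1.k (TGIndex.Mn d hL i.1))) (fgD d (TGIndex.Mn d hL i.1) (L ^ i.1.k) b μ)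
      (fun y y' => β * Real.exp (-(δ * (unitTorusGeo L i.1.k (TGIndex.Mn d hL i.1)).dist y y'))))
    (hG' : HasMaj (BlockNorm.ofBlocks (unitTorusGeo L i.1.k (TGIndex.Mn d hL i.1)) (blkFine L i.1.k (TGIndex.Mn d hL i.1) ∘ kingPrV L i.1.k i.1.m (TGIndex.Mn d hL i.1)))
      (BlockNorm.ofBlocks (unitTorusGeo L i.1.k (TGIndex.Mn d hL i.1)) (blkFine L i.1.k (TGIndex.Mn d hL i.1) ∘ kingPrV L i.1.k i.1.m (TGIndex.Mn d hL i.1)))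
      (gOp (TGIndex.Mn d hL i.1) (L ^ i.1.m * L ^ i.1.k) b) (fun y y' => β * Real.exp (-(δ * (unitTorusGeo L i.1.k (TGIndex.Mn d hL i.1)).dist y y'))))
    (hD' : ∀ μ, HasMaj (BlockNorm.ofBlocks (unitTorusGeo L i.1.k (TGIndex.Mn d hL i.1)) (blkFine L i.1.k (TGIndex.Mn d hL i.1) ∘ kingPrV L i.1.k i.1.m (TGIndex.Mn d hL i.1)))
      (BlockNorm.ofBlocks (unitTorusGeo L i.1.k (TGIndex.Mn d hL i.1)) (blkFine L i.1.k (TGIndex.Mn d hL i.1) ∘ kingPrV L i.1.k i.1.m (TGIndex.Mn d hL i.1)))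
      (fgD d (TGIndex.Mn d hL i.1) (L ^ i.1.m * L ^ i.1.k) b μ) (fun y y' => β * Real.exp (-(δ * (unitTorusGeo L i.1.k (TGIndex.Mn d hL i.1)).dist y y'))))
    (hDG : HasMaj (BlockNorm.ofBlocks (unitTorusGeo L i.1.k (TGIndex.Mn d hL i.1)) (blkFine L i.1.k (TGIndex.Mn d hL i.1)))
      (BlockNorm.ofBlocks (unitTorusGeo L i.1.k (TGIndex.Mn d hL i.1)) (blkFine L i.1.k (TGIndex.Mn d hL i.1) ∘ kingPrV L i.1.k i.1.m (TGIndex.Mn d hL i.1)))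
      (idef (pull (kingPrV L i.1.k i.1.m (TGIndex.Mn d hL i.1))) (pull (kingPrV L i.1.k i.1.m (TGIndex.Mn d hL i.1)))
        (gOp (TGIndex.Mn d hL i.1) (L ^ i.1.m * L ^ i.1.k) b) (gOp (TGIndex.Mn d hL i.1) (L ^ i.1.k) b))
      (fun y y' => m₀ * ((L : ℝ) ^ i.1.k) ^ (-(1 / 16 : ℝ)) * Real.exp (-(δ * (unitTorusGeo L i.1.k (TGIndex.Mn d hL i.1)).dist y y'))))
    (hDD : ∀ μ, HasMaj (BlockNorm.ofBlocks (unitTorusGeo L i.1.k (TGIndex.Mn d hL i.1)) (blkFine L i.1.k (TGIndex.Mn d hL i.1)))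
      (BlockNorm.ofBlocks (unitTorusGeo L i.1.k (TGIndex.Mn d hL i.1)) (blkFine L i.1.k (TGIndex.Mn d hL i.1) ∘ kingPrV L i.1.k i.1.m (TGIndex.Mn d hL i.1)))
      (idef (pull (kingPrV L i.1.k i.1.m (TGIndex.Mn d hL i.1))) (pull (kingPrV L i.1.k i.1.m (TGIndex.Mn d hL i.1)))
        (fgD d (TGIndex.Mn d hL i.1) (L ^ i.1.m * L ^ i.1.k) b μ) (fgD d (TGIndex.Mn d hL i.1) (L ^ i.1.k) b μ))
      (fun y y' => m₀ * ((L : ℝ) ^ i.1.k) ^ (-(1 / 16 : ℝ)) * Real.exp (-(δ * (unitTorusGeo L i.1.k (TGIndex.Mn d hL i.1)).dist y y'))))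
    {U : (fgInstanceC2 d hL i).Bf.Cfg} (hU : (fgInstanceC2 d hL i).Bf.Reg335 c35 α₀ U) :
    HasMaj (BlockNorm.ofBlocks (unitTorusGeo L i.1.k (TGIndex.Mn d hL i.1)) (fun bb : Tor (TGIndex.Mn d hL i.1) × Fin (d + 1) => bb.1))
        (BlockNorm.ofBlocks (unitTorusGeo L i.1.k (TGIndex.Mn d hL i.1)) (fun bb : Tor (TGIndex.Mn d hL i.1) × Fin (d + 1) => bb.1))
        (zOp d (TGIndex.Mn d hL i.1) (L ^ i.1.k) b (avg₁ (Fin (d + 1)) (kingPrV L i.1.k i.1.m (TGIndex.Mn d hL i.1)) U).1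
          (avg₁ (Fin (d + 1)) (kingPrV L i.1.k i.1.m (TGIndex.Mn d hL i.1)) U).2)
        (fun y y' => (2 * β ^ 2 * ((d : ℝ) + 2) * latticeConst (d + 1) (δ / 4) * ((2 * (d : ℝ) + 3) * c35) * Real.exp δ * latticeConst (d + 1) (δ / 4) * Real.exp δ) * α₀ *
          Real.exp (-(δ / 2 * tdistT (TGIndex.Mn d hL i.1) y y'))) ∧
      HasMaj (BlockNorm.ofBlocks (unitTorusGeo L i.1.k (TGIndex.Mn d hL i.1)) (fun bb : Tor (TGIndex.Mn d hL i.1) × Fin (d + 1) => bb.1))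
        (BlockNorm.ofBlocks (unitTorusGeo L i.1.k (TGIndex.Mn d hL i.1)) (fun bb : Tor (TGIndex.Mn d hL i.1) × Fin (d + 1) => bb.1))
        (zOp d (TGIndex.Mn d hL i.1) (L ^ i.1.m * L ^ i.1.k) b U.1 U.2)
        (fun y y' => (2 * β ^ 2 * ((d : ℝ) + 2) * latticeConst (d + 1) (δ / 4) * ((2 * (d : ℝ) + 3) * c35) * Real.exp δ * latticeConst (d + 1) (δ / 4) * Real.exp δ) * α₀ *
          Real.exp (-(δ / 2 * tdistT (TGIndex.Mn d hL i.1) y y'))) ∧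
      HasMaj (BlockNorm.ofBlocks (unitTorusGeo L i.1.k (TGIndex.Mn d hL i.1)) (fun bb : Tor (TGIndex.Mn d hL i.1) × Fin (d + 1) => bb.1))
        (BlockNorm.ofBlocks (unitTorusGeo L i.1.k (TGIndex.Mn d hL i.1)) (fun bb : Tor (TGIndex.Mn d hL i.1) × Fin (d + 1) => bb.1))
        (zOp d (TGIndex.Mn d hL i.1) (L ^ i.1.m * L ^ i.1.k) b U.1 U.2 -
          zOp d (TGIndex.Mn d hL i.1) (L ^ i.1.k) b (avg₁ (Fin (d + 1)) (kingPrV L i.1.k i.1.m (TGIndex.Mn d hL i.1)) U).1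
            (avg₁ (Fin (d + 1)) (kingPrV L i.1.k i.1.m (TGIndex.Mn d hL i.1)) U).2)
        (fun y y' => ((2 * β ^ 2 * ((d : ℝ) + 2) * latticeConst (d + 1) (δ / 4) * ((2 * (d : ℝ) + 3) * c35)) * 2 * Real.exp δ * latticeConst (d + 1) (δ / 4) * Real.exp δ
            + (bgConst β (latticeConst (d + 1) (δ / 4)) m₀ ((2 * (d : ℝ) + 3) * c35 * (1 + Fintype.card (Fin (d + 1)))) a₁ + m₀) * Real.exp δ * latticeConst (d + 1) (δ / 4) * Real.exp δ
            + β * (2 * β * ((2 * (d : ℝ) + 3) * c35) * ((d : ℝ) + 2)) * Real.exp δ * latticeConst (d + 1) (δ / 4) * latticeConst (d + 1) (δ / 4) * Real.exp δ)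
          * ((L : ℝ) ^ i.1.k) ^ (-(1 / 16 : ℝ)) * Real.exp (-(δ / 4 * tdistT (TGIndex.Mn d hL i.1) y y'))) := by
  -- abbreviations (plain facts)
  have hL1 : (1 : ℝ) ≤ (L : ℝ) := by exact_mod_cast hL.2.le
  have hLk : (1 : ℝ) ≤ (L : ℝ) ^ i.1.k := one_le_pow₀ hL1
  have hLk0 : (0 : ℝ) < (L : ℝ) ^ i.1.k := by positivity
  have hσ : 0 < δ / 4 := by positivity
  have hcr := latticeConst_nonneg (d + 1) hσ.le
  have hd0 : (0 : ℝ) ≤ d := Nat.cast_nonneg d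
  have hc' : 0 < (2 * (d : ℝ) + 3) * c35 := by positivity
  have hM1 : (unitTorusGeo L i.1.k (TGIndex.Mn d hL i.1)).M = 1 := rfl
  have hθ0 : 0 ≤ ((L : ℝ) ^ i.1.k) ^ (-(1 / 16 : ℝ)) := Real.rpow_nonneg hLk0.le _
  have hθinv : ((L : ℝ) ^ i.1.k)⁻¹ ≤ ((L : ℝ) ^ i.1.k) ^ (-(1 / 16 : ℝ)) := inv_pow_le_sixteenth hL1 i.1.k
  -- the coeffBg₁ letters at level c′ (FILE 11 `reg_slim_of_C2`, component 1)
  have hcα : 0 ≤ c35 * (unitTorusGeo L i.1.k (TGIndex.Mn d hL i.1)).M * α₀ := by rw [hM1]; positivity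
  obtain ⟨⟨⟨hsc, hsa⟩, hoc, hoa⟩, -⟩ := reg_slim_of_C2 (γ := (1 / 16 : ℝ)) hL (by norm_num) i hcα U hU
  rw [hM1, mul_one] at hsc hsa
  -- the sup letter r = c′α₀ and the guards
  have hr0 : 0 ≤ (2 * (d : ℝ) + 3) * c35 * α₀ := by positivity
  have hq1 : β * ((2 * (d : ℝ) + 3) * c35 * α₀ * ((d : ℝ) + 2)) * latticeConst (d + 1) (δ / 4) ≤ 1 / 2 := by
    have : β * ((2 * (d : ℝ) + 3) * c35 * α₀ * ((d : ℝ) + 2)) * latticeConst (d + 1) (δ / 4)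
        = β * ((2 * (d : ℝ) + 3) * c35 * ((d : ℝ) + 2)) * latticeConst (d + 1) (δ / 4) * α₀ := by ring
    rw [this]
    exact (mul_le_mul_of_nonneg_left hα₁ (by positivity)).trans hq
  have hq1' : β * ((2 * (d : ℝ) + 3) * c35 * α₀ * ((d : ℝ) + 2)) * latticeConst (d + 1) (δ / 4) < 1 := by linarith
  have hinv : (1 - β * ((2 * (d : ℝ) + 3) * c35 * α₀ * ((d : ℝ) + 2)) * latticeConst (d + 1) (δ / 4))⁻¹ ≤ 2 := B9SectDSup.inv_one_sub_le_two hq1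
  have hinv0 : 0 ≤ (1 - β * ((2 * (d : ℝ) + 3) * c35 * α₀ * ((d : ℝ) + 2)) * latticeConst (d + 1) (δ / 4))⁻¹ := inv_nonneg.mpr (by linarith)
  -- coarse coefficients = block averages
  have hc : ∀ x, |(avg₁ (Fin (d + 1)) (kingPrV L i.1.k i.1.m (TGIndex.Mn d hL i.1)) U).1 x| ≤ (2 * (d : ℝ) + 3) * c35 * α₀ :=
    abs_blockAvg_le _ hr0 hsc
  have ha : ∀ μ x, |(avg₁ (Fin (d + 1)) (kingPrV L i.1.k i.1.m (TGIndex.Mn d hL i.1)) U).2 μ x| ≤ (2 * (d : ℝ) + 3) * c35 * α₀ :=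
    fun μ => abs_blockAvg_le _ hr0 (hsa μ)
  -- rates
  have hρ₁ : 0 ≤ δ - δ / 4 := by linarith
  have hρ₁δ : δ - δ / 4 + δ / 4 ≤ δ := by linarith
  -- (i) the increments' majorants (file U-C `hasMaj_wOp`), coarse and fine
  have hW := hasMaj_wOp (L := L) (M := TGIndex.Mn d hL i.1) i.1.k (blkFine L i.1.k (TGIndex.Mn d hL i.1)) hβ hr0 hσ hρ₁ hρ₁δ hG hD hc ha hq1'
  have hW' := hasMaj_wOp (L := L) (M := TGIndex.Mn d hL i.1) i.1.k (blkFine L i.1.k (TGIndex.Mn d hL i.1) ∘ kingPrV L i.1.k i.1.m (TGIndex.Mn d hL i.1))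
    hβ hr0 hσ hρ₁ hρ₁δ hG' hD' hsc hsa hq1'
  rw [blkFine_comp_kingPrV] at hW'
  -- ABSTRACT THE AMPLITUDES (plain atoms; no `set`)
  obtain ⟨BW, hBW⟩ : ∃ x : ℝ, β * ((2 * (d : ℝ) + 3) * c35 * α₀ * ((d : ℝ) + 2) *
      (β * (1 - β * ((2 * (d : ℝ) + 3) * c35 * α₀ * ((d : ℝ) + 2)) * latticeConst (d + 1) (δ / 4))⁻¹)) * latticeConst (d + 1) (δ / 4) = x := ⟨_, rfl⟩
  obtain ⟨A, hA⟩ : ∃ x : ℝ, (2 * (d : ℝ) + 3) * c35 * α₀ * ((d : ℝ) + 2) *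
      (β * (1 - β * ((2 * (d : ℝ) + 3) * c35 * α₀ * ((d : ℝ) + 2)) * latticeConst (d + 1) (δ / 4))⁻¹) = x := ⟨_, rfl⟩
  obtain ⟨θ, hθ⟩ : ∃ x : ℝ, ((L : ℝ) ^ i.1.k) ^ (-(1 / 16 : ℝ)) = x := ⟨_, rfl⟩
  obtain ⟨cr, hcr'⟩ : ∃ x : ℝ, latticeConst (d + 1) (δ / 4) = x := ⟨_, rfl⟩
  have hA0 : 0 ≤ A := by rw [← hA]; exact mul_nonneg (by positivity) (mul_nonneg hβ hinv0)
  have hAle : A ≤ 2 * β * ((2 * (d : ℝ) + 3) * c35) * ((d : ℝ) + 2) := by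
    rw [← hA]
    have h1 : β * (1 - β * ((2 * (d : ℝ) + 3) * c35 * α₀ * ((d : ℝ) + 2)) * latticeConst (d + 1) (δ / 4))⁻¹ ≤ β * 2 := mul_le_mul_of_nonneg_left hinv hβ
    have hα1 : α₀ ≤ 1 := hα₁.trans ha₁
    have h2 : (2 * (d : ℝ) + 3) * c35 * α₀ * ((d : ℝ) + 2) ≤ (2 * (d : ℝ) + 3) * c35 * 1 * ((d : ℝ) + 2) :=
      mul_le_mul_of_nonneg_right (mul_le_mul_of_nonneg_left hα1 hc'.le) (by positivity)
    calc _ ≤ (2 * (d : ℝ) + 3) * c35 * 1 * ((d : ℝ) + 2) * (β * 2) := mul_le_mul h2 h1 (mul_nonneg hβ hinv0) (by positivity)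
      _ = _ := by ring
  have hBWA : BW = β * A * cr := by rw [← hBW, ← hA, ← hcr']
  have hBW0 : 0 ≤ BW := by rw [hBWA, ← hcr']; exact mul_nonneg (mul_nonneg hβ hA0) hcr
  have hBWle : BW ≤ 2 * β ^ 2 * ((d : ℝ) + 2) * cr * ((2 * (d : ℝ) + 3) * c35) * α₀ := by
    rw [hBWA, ← hA]
    have h1 : β * (1 - β * ((2 * (d : ℝ) + 3) * c35 * α₀ * ((d : ℝ) + 2)) * latticeConst (d + 1) (δ / 4))⁻¹ ≤ β * 2 := mul_le_mul_of_nonneg_left hinv hβ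
    have hcr0 : 0 ≤ cr := by rw [← hcr']; exact hcr
    calc β * ((2 * (d : ℝ) + 3) * c35 * α₀ * ((d : ℝ) + 2) * (β * (1 - β * ((2 * (d : ℝ) + 3) * c35 * α₀ * ((d : ℝ) + 2)) * latticeConst (d + 1) (δ / 4))⁻¹)) * cr
        ≤ β * ((2 * (d : ℝ) + 3) * c35 * α₀ * ((d : ℝ) + 2) * (β * 2)) * cr :=
          mul_le_mul_of_nonneg_right (mul_le_mul_of_nonneg_left (mul_le_mul_of_nonneg_left h1 (by positivity)) hβ) hcr0
      _ = _ := by ring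
  have hθ0' : 0 ≤ θ := by rw [← hθ]; exact hθ0
  have hθ1 : ((L : ℝ) ^ i.1.k)⁻¹ ≤ θ := by rw [← hθ]; exact hθinv
  have hcr0 : 0 ≤ cr := by rw [← hcr']; exact hcr
  have hcast : (((L ^ i.1.k : ℕ) : ℝ))⁻¹ = ((L : ℝ) ^ i.1.k)⁻¹ := by push_cast; ring
  have hLinv0 : 0 ≤ ((L : ℝ) ^ i.1.k)⁻¹ := inv_nonneg.mpr hLk0.le
  have hexp2 : Real.exp (δ / 2) ≤ Real.exp δ := Real.exp_le_exp.mpr (by linarith)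
  have hexp3 : Real.exp (δ / 2 - δ / 4) ≤ Real.exp δ := Real.exp_le_exp.mpr (by linarith)
  have hexpδ : Real.exp (δ - δ / 4) ≤ Real.exp δ := Real.exp_le_exp.mpr (by linarith)
  have hexpδ' : Real.exp (δ - δ / 4 - δ / 4) ≤ Real.exp δ := Real.exp_le_exp.mpr (by linarith)
  rw [hBW] at hW hW'
  rw [hθ, hcr']
  -- (ii) the middle factors (file U-C `hasMaj_zOp`) at rate δ/2
  have hZ := hasMaj_zOp (L := L) (M := TGIndex.Mn d hL i.1) (k := i.1.k) (σ := δ / 4) (ρ := δ - δ / 4) hBW0 hσ (by linarith) hW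
  have hZ' := hasMaj_zOp (L := L) (M := TGIndex.Mn d hL i.1) (k := i.1.k) (σ := δ / 4) (ρ := δ - δ / 4) hBW0 hσ (by linarith) hW'
  rw [hcr'] at hZ hZ'
  have hZamp : 1 * BW * (1 * Real.exp (δ - δ / 4)) * cr * Real.exp (δ - δ / 4 - δ / 4)
      ≤ (2 * β ^ 2 * ((d : ℝ) + 2) * cr * ((2 * (d : ℝ) + 3) * c35) * Real.exp δ * cr * Real.exp δ) * α₀ := by
    have hζ₁0 : 0 ≤ 2 * β ^ 2 * ((d : ℝ) + 2) * cr * ((2 * (d : ℝ) + 3) * c35) * α₀ := by positivity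
    calc 1 * BW * (1 * Real.exp (δ - δ / 4)) * cr * Real.exp (δ - δ / 4 - δ / 4) = BW * (Real.exp (δ - δ / 4) * (cr * Real.exp (δ - δ / 4 - δ / 4))) := by ring
      _ ≤ (2 * β ^ 2 * ((d : ℝ) + 2) * cr * ((2 * (d : ℝ) + 3) * c35) * α₀) * (Real.exp δ * (cr * Real.exp δ)) :=
          mul_le_mul hBWle (mul_le_mul hexpδ (mul_le_mul_of_nonneg_left hexpδ' hcr0) (by positivity) (Real.exp_nonneg _)) (by positivity) hζ₁0
      _ = _ := by ring
  have erate : ∀ y y' : Tor (TGIndex.Mn d hL i.1), Real.exp (-((δ - δ / 4 - δ / 4) * tdistT (TGIndex.Mn d hL i.1) y y')) = Real.exp (-(δ / 2 * tdistT (TGIndex.Mn d hL i.1) y y')) :=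
    fun y y' => by congr 1; ring
  refine ⟨hZ.mono fun y y' => ?_, hZ'.mono fun y y' => ?_, ?_⟩
  · rw [erate]; exact mul_le_mul_of_nonneg_right hZamp (Real.exp_nonneg _)
  · rw [erate]; exact mul_le_mul_of_nonneg_right hZamp (Real.exp_nonneg _)
  -- (iii) the η-difference (file U-C `hasMaj_zOp_sub`)
  -- the background-live entry-0 defect (n15-b B4) at the coeffBg₁ letters, minus entry 0 of the `U ≡ 1` pair
  have hreg₁ : (BackgroundLayer.coeffBg₁ (Fin (d + 1)) (kingPrV L i.1.k i.1.m (TGIndex.Mn d hL i.1)) (1 : ℝ) (((L : ℝ) ^ i.1.k) ^ (-(1 / 16 : ℝ)))).Reg335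
      ((2 * (d : ℝ) + 3) * c35) α₀ U := by
    refine ⟨⟨?_, ?_⟩, ?_, ?_⟩
    · intro x'; simpa [mul_one] using hsc x'
    · intro μ x'; simpa [mul_one] using hsa μ x'
    · simpa [hM1] using hoc
    · simpa [hM1] using hoa
  have hqE : β * ((2 * (d : ℝ) + 3) * c35 * (1 + Fintype.card (Fin (d + 1))) * a₁) * latticeConst (d + 1) (δ / 4) ≤ 1 / 2 := by
    rw [card_letter]
    have : β * ((2 * (d : ℝ) + 3) * c35 * ((d : ℝ) + 2) * a₁) * latticeConst (d + 1) (δ / 4)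
        = β * ((2 * (d : ℝ) + 3) * c35 * ((d : ℝ) + 2)) * latticeConst (d + 1) (δ / 4) * a₁ := by ring
    rw [this]; exact hq
  have h01 := hasMaj_entry01_background₁ (g := unitTorusGeo L i.1.k (TGIndex.Mn d hL i.1)) (blkFine L i.1.k (TGIndex.Mn d hL i.1)) (kingPrV L i.1.k i.1.m (TGIndex.Mn d hL i.1))
    (triangle254_unitTorusGeo (L := L) (k := i.1.k) (M := TGIndex.Mn d hL i.1)) (unitTorusGeo_dist_nonneg (L := L) (k := i.1.k) (M := TGIndex.Mn d hL i.1)) hσ.le hcr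
    (rowSum_unitTorusGeo (L := L) (k := i.1.k) (M := TGIndex.Mn d hL i.1) hσ) (δ := δ) (by linarith) hβ hm₀ hθ0 hc' hqE le_rfl hα₀
    (by rw [one_mul]; exact hα₁) hG hD hG' hD' hDG hDD hreg₁ none
  rw [hθ, hcr'] at h01
  obtain ⟨CB, hCB⟩ : ∃ x : ℝ, bgConst β cr m₀ ((2 * (d : ℝ) + 3) * c35 * (1 + Fintype.card (Fin (d + 1)))) a₁ = x := ⟨_, rfl⟩
  have hCB0 : 0 ≤ CB := by
    rw [← hCB]
    exact bgConst_nonneg hβ hcr0 hm₀ (by positivity : (0 : ℝ) ≤ (2 * (d : ℝ) + 3) * c35 * (1 + Fintype.card (Fin (d + 1)))) (hα₀.le.trans hα₁)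
  rw [hCB] at h01
  rw [hθ] at hDG
  have hE0 := h01.sub hDG
  have hE : HasMaj (BlockNorm.ofBlocks (unitTorusGeo L i.1.k (TGIndex.Mn d hL i.1)) (blkFine L i.1.k (TGIndex.Mn d hL i.1)))
      (BlockNorm.ofBlocks (unitTorusGeo L i.1.k (TGIndex.Mn d hL i.1)) (fun j : Tor (fine (L ^ i.1.m * L ^ i.1.k) (TGIndex.Mn d hL i.1)) × Fin (d + 1) =>
        blockOf (L ^ i.1.m * L ^ i.1.k) (TGIndex.Mn d hL i.1) j.1))
      (idef (pull (kingPrV L i.1.k i.1.m (TGIndex.Mn d hL i.1))) (pull (kingPrV L i.1.k i.1.m (TGIndex.Mn d hL i.1)))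
        (wOp d (TGIndex.Mn d hL i.1) (L ^ i.1.m * L ^ i.1.k) b U.1 U.2)
        (wOp d (TGIndex.Mn d hL i.1) (L ^ i.1.k) b (avg₁ (Fin (d + 1)) (kingPrV L i.1.k i.1.m (TGIndex.Mn d hL i.1)) U).1
          (avg₁ (Fin (d + 1)) (kingPrV L i.1.k i.1.m (TGIndex.Mn d hL i.1)) U).2))
      (fun y y' => (CB + m₀) * θ * Real.exp (-(δ / 2 * tdistT (TGIndex.Mn d hL i.1) y y'))) := by
    rw [← blkFine_comp_kingPrV]
    unfold wOp e0Op
    rw [idef_sub_sub]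
    refine hE0.mono fun y y' => ?_
    have hdy : 0 ≤ tdistT (TGIndex.Mn d hL i.1) y y' := tdistT_nonneg _ y y'
    have e1 : Real.exp (-((δ - δ / 4) * tdistT (TGIndex.Mn d hL i.1) y y')) ≤ Real.exp (-(δ / 2 * tdistT (TGIndex.Mn d hL i.1) y y')) :=
      Real.exp_le_exp.mpr (by nlinarith)
    have e2 : Real.exp (-(δ * tdistT (TGIndex.Mn d hL i.1) y y')) ≤ Real.exp (-(δ / 2 * tdistT (TGIndex.Mn d hL i.1) y y')) :=
      Real.exp_le_exp.mpr (by nlinarith)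
    calc CB * θ * Real.exp (-((δ - δ / 4) * tdistT (TGIndex.Mn d hL i.1) y y')) + m₀ * θ * Real.exp (-(δ * tdistT (TGIndex.Mn d hL i.1) y y'))
        ≤ CB * θ * Real.exp (-(δ / 2 * tdistT (TGIndex.Mn d hL i.1) y y')) + m₀ * θ * Real.exp (-(δ / 2 * tdistT (TGIndex.Mn d hL i.1) y y')) :=
          add_le_add (mul_le_mul_of_nonneg_left e1 (mul_nonneg hCB0 hθ0')) (mul_le_mul_of_nonneg_left e2 (mul_nonneg hm₀ hθ0'))
      _ = _ := by ring
  -- the gradient letter (file U-C `hasMaj_grad_wOp_qvAdj`)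
  have hunit := isUnit_pair (L := L) (M := TGIndex.Mn d hL i.1) i.1.k (blkFine L i.1.k (TGIndex.Mn d hL i.1)) hβ hr0 hσ (by linarith : δ / 4 ≤ δ) hG hD hc ha hq1'
  have hVX := hasMaj_VX (L := L) (M := TGIndex.Mn d hL i.1) i.1.k (blkFine L i.1.k (TGIndex.Mn d hL i.1)) hβ hr0 hσ hρ₁ hρ₁δ hG hD hc ha hq1'
  rw [hA] at hVX
  have hDW := fun κ => hasMaj_grad_wOp_qvAdj (L := L) (M := TGIndex.Mn d hL i.1) i.1.k (σ := δ / 4) (ρ := δ - δ / 4) (δ := δ) hβ hA0 hσ (by linarith) hρ₁δ hunit hD hVX κ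
  -- feed `hasMaj_zOp_sub` at the common rate δ/2
  have hW'₂ := hW'.mono fun y y' => by
    have hdy : 0 ≤ tdistT (TGIndex.Mn d hL i.1) y y' := tdistT_nonneg _ y y'
    exact (mul_le_mul_of_nonneg_left (Real.exp_le_exp.mpr (by nlinarith) :
      Real.exp (-((δ - δ / 4) * tdistT (TGIndex.Mn d hL i.1) y y')) ≤ Real.exp (-(δ / 2 * tdistT (TGIndex.Mn d hL i.1) y y'))) hBW0)
  have hDW₂ : ∀ κ, HasMaj (BlockNorm.ofBlocks (unitTorusGeo L i.1.k (TGIndex.Mn d hL i.1)) (fun bb : Tor (TGIndex.Mn d hL i.1) × Fin (d + 1) => bb.1))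
      (BlockNorm.ofBlocks (unitTorusGeo L i.1.k (TGIndex.Mn d hL i.1)) (blkFine L i.1.k (TGIndex.Mn d hL i.1)))
      ((((L ^ i.1.k : ℕ) : ℝ)⁻¹ • symbOp (TGIndex.Mn d hL i.1) (L ^ i.1.k) (sD (TGIndex.Mn d hL i.1) (L ^ i.1.k) κ ((L ^ i.1.k : ℕ) : ℝ))) ∘ₗ
        (wOp d (TGIndex.Mn d hL i.1) (L ^ i.1.k) b (avg₁ (Fin (d + 1)) (kingPrV L i.1.k i.1.m (TGIndex.Mn d hL i.1)) U).1
          (avg₁ (Fin (d + 1)) (kingPrV L i.1.k i.1.m (TGIndex.Mn d hL i.1)) U).2 ∘ₗ qvAdjRe (TGIndex.Mn d hL i.1) (L ^ i.1.k)))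
      (fun y y' => ((L : ℝ) ^ i.1.k)⁻¹ * (β * A * Real.exp (δ - δ / 4) * cr * cr) * Real.exp (-(δ / 2 * tdistT (TGIndex.Mn d hL i.1) y y'))) := fun κ =>
    (hDW κ).mono fun y y' => le_of_eq (by rw [hcast, ← hcr', show δ - δ / 4 - δ / 4 = δ / 2 by ring]; ring)
  have hβD0 : 0 ≤ ((L : ℝ) ^ i.1.k)⁻¹ * (β * A * Real.exp (δ - δ / 4) * cr * cr) := by positivity
  have hsub := hasMaj_zOp_sub (L := L) (M := TGIndex.Mn d hL i.1) i.1.k i.1.m (σ := δ / 4) (ρ := δ / 2) hBW0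
    (mul_nonneg (add_nonneg hCB0 hm₀) hθ0') hβD0 hσ (by linarith) hW'₂ hE hDW₂
  rw [hcr'] at hsub
  refine hsub.mono fun y y' => ?_
  have erate2 : Real.exp (-((δ / 2 - δ / 4) * tdistT (TGIndex.Mn d hL i.1) y y')) = Real.exp (-(δ / 4 * tdistT (TGIndex.Mn d hL i.1) y y')) := by congr 1; ring
  rw [erate2]
  refine mul_le_mul_of_nonneg_right ?_ (Real.exp_nonneg _)
  rw [hCB]
  -- the three amplitudes against θ
  have hζ₁0 : 0 ≤ 2 * β ^ 2 * ((d : ℝ) + 2) * cr * ((2 * (d : ℝ) + 3) * c35) := by positivity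
  have hBW1 : BW ≤ 2 * β ^ 2 * ((d : ℝ) + 2) * cr * ((2 * (d : ℝ) + 3) * c35) := by
    have hα1 : α₀ ≤ 1 := hα₁.trans ha₁
    exact hBWle.trans (by nlinarith)
  -- term 1
  have t1 : 1 * BW * (2 * Real.exp (δ / 2) / (L : ℝ) ^ i.1.k * 1) * cr * Real.exp (δ / 2 - δ / 4)
      ≤ (2 * cr) * ((2 * β ^ 2 * ((d : ℝ) + 2) * cr * ((2 * (d : ℝ) + 3) * c35)) * (Real.exp δ * (Real.exp δ * θ))) := by
    have e : 1 * BW * (2 * Real.exp (δ / 2) / (L : ℝ) ^ i.1.k * 1) * cr * Real.exp (δ / 2 - δ / 4)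
        = (2 * cr) * (BW * (Real.exp (δ / 2) * (Real.exp (δ / 2 - δ / 4) * ((L : ℝ) ^ i.1.k)⁻¹))) := by rw [div_eq_mul_inv]; ring
    rw [e]
    refine mul_le_mul_of_nonneg_left ?_ (by positivity)
    exact mul_le_mul hBW1 (mul_le_mul hexp2 (mul_le_mul hexp3 hθ1 hLinv0 (Real.exp_nonneg _)) (by positivity) (Real.exp_nonneg _)) (by positivity) hζ₁0
  -- term 2
  have t2 : 1 * ((CB + m₀) * θ) * (1 * Real.exp (δ / 2)) * cr * Real.exp (δ / 2 - δ / 4)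
      ≤ ((CB + m₀) * cr * θ) * (Real.exp δ * Real.exp δ) := by
    have e : 1 * ((CB + m₀) * θ) * (1 * Real.exp (δ / 2)) * cr * Real.exp (δ / 2 - δ / 4) = ((CB + m₀) * cr * θ) * (Real.exp (δ / 2) * Real.exp (δ / 2 - δ / 4)) := by ring
    rw [e]
    exact mul_le_mul_of_nonneg_left (mul_le_mul hexp2 hexp3 (Real.exp_nonneg _) (Real.exp_nonneg _)) (by positivity)
  -- term 3
  have hA10 : 0 ≤ 2 * β * ((2 * (d : ℝ) + 3) * c35) * ((d : ℝ) + 2) := by positivity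
  have t3 : ((L : ℝ) ^ i.1.k)⁻¹ * (β * A * Real.exp (δ - δ / 4) * cr * cr) * Real.exp (δ / 2)
      ≤ (β * cr * cr) * ((2 * β * ((2 * (d : ℝ) + 3) * c35) * ((d : ℝ) + 2)) * (Real.exp δ * (Real.exp δ * θ))) := by
    have e : ((L : ℝ) ^ i.1.k)⁻¹ * (β * A * Real.exp (δ - δ / 4) * cr * cr) * Real.exp (δ / 2)
        = (β * cr * cr) * (A * (Real.exp (δ - δ / 4) * (Real.exp (δ / 2) * ((L : ℝ) ^ i.1.k)⁻¹))) := by ring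
    rw [e]
    refine mul_le_mul_of_nonneg_left ?_ (by positivity)
    exact mul_le_mul hAle (mul_le_mul hexpδ (mul_le_mul hexp2 hθ1 hLinv0 (Real.exp_nonneg _)) (by positivity) (Real.exp_nonneg _)) (by positivity) hA10
  have := add_le_add (add_le_add t1 t2) t3
  refine this.trans (le_of_eq ?_)
  ring

end AtIndex

end Summit.QuantumFields.YangMills.BalabanUVNodes.N15.UnitLayerBg

end
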